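import Summits.HubbardSuperconductivity.HubbardSuperconductivity.Theses.ChiralWindow
import Summits.HubbardSuperconductivity.HubbardSuperconductivity.Theorems.CwSsbToEvenTorusLRO.Negative.BlockStubEncodingConverse
import Summits.HubbardSuperconductivity.HubbardSuperconductivity.Theorems.WcbcsSsbToTorusLRO.Negative.BlockRepulsionDominatesPairOrder
import Summits.HubbardSuperconductivity.HubbardSuperconductivity.Theorems.SsbToEvenTorusLro.Negative.MatrixClausesAndBox
import Literature.MathematicalPhysics.QuantumLattice.FinDimSpectrumProofs
import Literature.MathematicalPhysics.QuantumLattice.FermionOperatorsProofs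
import Literature.MathematicalPhysics.QuantumLattice.DWaveSourceProofs

/-!
# Crux `CwSsbToEvenTorusLRO` (item `stmt-HubbardSuperconductivity-10439`): the open stub
`stub_repelledOrderPersistence` (S2) of line `griffiths-block-slope` under the adversary — negative-side support
from the standing disprover (generation 3), file 1 of 2: tracial Cauchy–Schwarz, tracial block domination, the
`κ`-ceiling

The lead's skeleton `Cruxes/CwSsbToEvenTorusLRO/Lines/griffiths-block-slope.lean` (skeleton `61d14e7f2ae3`) closes
the crux from five stubs; four are finite-`L` (S1 `stub_blockSlope`, S4 `stub_sourceRemoval`, S5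
`stub_sectorFloorGC`) or an existing item (S3 = stmt-9491), and ONE is the open bet S2
`stub_repelledOrderPersistence`: Koma–Tasaki `d`-wave order of the block-REPELLED sourced torus
`T_h + κ W_R` (`T_h = dWaveSourceTorus L U μ h`, `W_R = R⁻⁴ Σ_a B_aᴴ B_a`, `B_a = Σ_{u ∈ [0,R)²} P_{a+u}`,
`P = pairField dWaveFormFactor L`) with an `R`-uniform floor `a` and an `R`-dependent coupling `κ(R) > 0`.
On the literal terms of the stubs (block operator spelled out; no definitions):

* `normSq_groundStateFunctional_le` — **Cauchy–Schwarz for the TRACIAL ground state** `ω_A` of any Hermitian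
  `A`: `|ω_A(B)|² ≤ re ω_A(Bᴴ B)` (positivity of `ω_A` on `(B - ω(B))ᴴ(B - ω(B))`); `re_groundStateFunctional_mono`
  — `ω_A` respects vector-level domination of Hermitian forms;
* `sq_re_gsf_pairField_le_blockRepulsion` — **tracial block domination**: `(re ω_A(P))² ≤ L² · re ω_A(W_R)` for
  every Hermitian `A` and every scale `R ≥ 1` (the twin's vector-level `re⟨P†P⟩ ≤ L² re⟨W_R⟩`,
  `Negative/BlockRepulsionDominatesPairOrder.lean`, transported to the possibly DEGENERATE ground space) — this is
  the second half of S1 exactly as the skeleton needs it (the ground state of `T_h + κW_R` may be degenerate);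
* `mul_re_gsf_le_rayleigh_sub_groundEnergy` — **the `κ`-ceiling** (abstract): for Hermitian `T, W`, a unit vector
  `v` with `W v = 0` and any real `κ`, the tracial ground state of `T + κW` has
  `κ · re ω(W) ≤ re⟨v, T v⟩ - E₀(T)`;
* `blockOp_mulVec_vacuum`, `re_vacuum_expect_dWaveSourceTorus` — the Fock vacuum is in the kernel of every
  `W_R` and has `⟨∅, T_h ∅⟩ = 0`; hence `repelled_pairAmplitude_sq_le`: **for the block-repelled sourced torus,
  `κ · (re ω_{h,κ,R}(P))² ≤ -L² · E₀(T_h)`** (`κ ≥ 0`): an `R`-uniform floor `a ≤ re ω(P)/L²` as in S2 forces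
  `κ(R) · a² ≤ -E₀(T_h)/L²` (file 2 makes the bound explicit and refutes the `∀κ` strengthening of S2).

Folklore finite-dimensional bookkeeping (Tasaki 2020 §2.1: variational principle, tracial ground state).
Workfile: `Cruxes/CwSsbToEvenTorusLRO/Disproof.lean` §6b–§6c (gen 3).
-/

noncomputable section

namespace Summit.HubbardSuperconductivity.HubbardSuperconductivity.Theorems.CwSsbToEvenTorusLRO.Negative

open Matrix Literature.MathematicalPhysics.QuantumLattice
open Literature.Probability.LatticeModels (TorusSite Site)
open Summit.HubbardSuperconductivity.WcbcsSsbToTorusLRO.Negative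
  (sum_blockPair re_expect_pairIntensity_le_sq_mul_blockRepulsion)
open Summit.HubbardSuperconductivity.HubbardSuperconductivity.Theorems.SsbToEvenTorusLro.Negative
  (star_vacuum_dotProduct_vacuum localPair_mulVec_vacuum)
open Filter Set
open scoped Matrix ComplexOrder Matrix.Norms.L2Operator
open _root_.Topology

/-! ### 1. Cauchy–Schwarz and monotonicity for the tracial ground-state functional -/

section MixedState

variable {n : Type*} [Fintype n] [DecidableEq n]

/-- `(B - c)ᴴ(B - c) = BᴴB - c Bᴴ - c̄ B + c c̄`. [folklore] -/
theorem conjTranspose_sub_smul_one_mul_self (B : Matrix n n ℂ) (c : ℂ) :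
    (B - c • (1 : Matrix n n ℂ))ᴴ * (B - c • (1 : Matrix n n ℂ)) =
      Bᴴ * B - c • Bᴴ - (star c) • B + (c * star c) • (1 : Matrix n n ℂ) := by
  simp only [conjTranspose_sub, conjTranspose_smul, conjTranspose_one, sub_mul, mul_sub, Matrix.mul_smul,
    Matrix.smul_mul, Matrix.mul_one, Matrix.one_mul, smul_smul]
  abel

/-- **Cauchy–Schwarz for the tracial ground state**: `|ω_A(B)|² ≤ re ω_A(Bᴴ B)` for Hermitian `A` on a
nonempty index type (positivity of `ω_A` on `(B - ω(B)·1)ᴴ (B - ω(B)·1)`, `ω(1) = 1`, `ω(Bᴴ) = conj ω(B)`).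
[cite: Tasaki2020, §2.1] -/
theorem normSq_groundStateFunctional_le {A : Matrix n n ℂ} (hA : A.IsHermitian) [Nonempty n]
    (B : Matrix n n ℂ) :
    Complex.normSq (A.groundStateFunctional B) ≤ (A.groundStateFunctional (Bᴴ * B)).re := by
  set c : ℂ := A.groundStateFunctional B with hc
  have hpos := groundStateFunctional_nonneg A (B - c • (1 : Matrix n n ℂ))
  rw [conjTranspose_sub_smul_one_mul_self, map_add, map_sub, map_sub, LinearMap.map_smul,
    LinearMap.map_smul, LinearMap.map_smul, groundStateFunctional_conjTranspose,
    groundStateFunctional_one hA, ← hc] at hpos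
  obtain ⟨hre, -⟩ := Complex.nonneg_iff.mp hpos
  have h1 : (c * star c).re = Complex.normSq c := by
    rw [Complex.star_def, Complex.mul_conj, Complex.ofReal_re]
  have h2 : (star c * c).re = Complex.normSq c := by
    rw [mul_comm]; exact h1
  simp only [smul_eq_mul, mul_one, Complex.sub_re, Complex.add_re, h1, h2] at hre
  linarith

/-- `(re ω_A(B))² ≤ re ω_A(Bᴴ B)`. [cite: Tasaki2020, §2.1] -/
theorem sq_re_groundStateFunctional_le {A : Matrix n n ℂ} (hA : A.IsHermitian) [Nonempty n]
    (B : Matrix n n ℂ) :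
    (A.groundStateFunctional B).re ^ 2 ≤ (A.groundStateFunctional (Bᴴ * B)).re := by
  have h := normSq_groundStateFunctional_le hA B
  rw [Complex.normSq_apply] at h
  nlinarith [sq_nonneg (A.groundStateFunctional B).im]

omit [DecidableEq n] in
/-- **The tracial ground state respects vector-level domination**: if `re⟨x, X x⟩ ≤ re⟨x, Y x⟩` for every vector
and `X, Y` are Hermitian, then `re ω_A(X) ≤ re ω_A(Y)` (`Y - X` is positive semidefinite; positivity of `ω_A`).
[cite: Tasaki2020, §2.1] -/
theorem re_groundStateFunctional_mono [DecidableEq n] {A X Y : Matrix n n ℂ} (hX : X.IsHermitian)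
    (hY : Y.IsHermitian) (h : ∀ x : n → ℂ, (star x ⬝ᵥ X *ᵥ x).re ≤ (star x ⬝ᵥ Y *ᵥ x).re) :
    (A.groundStateFunctional X).re ≤ (A.groundStateFunctional Y).re := by
  have hPSD : (Y - X).PosSemidef := by
    refine Matrix.PosSemidef.of_dotProduct_mulVec_nonneg (hY.sub hX) fun x => ?_
    rw [Complex.nonneg_iff]
    constructor
    · rw [sub_mulVec, dotProduct_sub, Complex.sub_re]
      linarith [h x]
    · have := (hY.sub hX).im_star_dotProduct_mulVec_self x
      simpa using this.symm
  have h0 := groundStateFunctional_nonneg_of_posSemidef A hPSD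
  rw [map_sub] at h0
  obtain ⟨hre, -⟩ := Complex.nonneg_iff.mp h0
  rw [Complex.sub_re] at hre
  linarith

/-- **The `κ`-ceiling** (abstract form): for Hermitian `T, W`, a unit vector `v` in the kernel of `W` and a real
coupling `κ`, the tracial ground state `ω` of `T + κ W` satisfies `κ · re ω(W) ≤ re⟨v, T v⟩ - E₀(T)`
(`E₀(T + κW) = re ω(T) + κ re ω(W) ≥ E₀(T) + κ re ω(W)` and `E₀(T + κW) ≤ ⟨v, (T + κW) v⟩ = ⟨v, T v⟩`).
[cite: Tasaki2020, §2.1] -/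
theorem mul_re_gsf_le_rayleigh_sub_groundEnergy {T W : Matrix n n ℂ} (hT : T.IsHermitian)
    (hW : W.IsHermitian) [Nonempty n] (κ : ℝ) {v : n → ℂ} (hv : star v ⬝ᵥ v = 1) (hWv : W *ᵥ v = 0) :
    κ * ((T + (κ : ℂ) • W).groundStateFunctional W).re ≤ (star v ⬝ᵥ T *ᵥ v).re - T.groundEnergy := by
  have hA := isHermitian_add_real_smul hT hW κ
  have h1 : (T + (κ : ℂ) • W).groundEnergy =
      ((T + (κ : ℂ) • W).groundStateFunctional T).re +
        κ * ((T + (κ : ℂ) • W).groundStateFunctional W).re := by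
    have e : ((T + (κ : ℂ) • W).groundStateFunctional (T + (κ : ℂ) • W)).re =
        (T + (κ : ℂ) • W).groundEnergy := by
      rw [groundStateFunctional_hamiltonian hA, Complex.ofReal_re]
    rw [← e, map_add, LinearMap.map_smul, Complex.add_re, smul_eq_mul, Complex.re_ofReal_mul]
  have h2 := groundEnergy_le_groundStateFunctional_re hA hT
  have h3 := groundEnergy_le_rayleigh_holds hA v hv
  rw [re_rayleigh_affine, hWv, dotProduct_zero, Complex.zero_re, mul_zero, add_zero] at h3
  linarith

end MixedState

/-! ### 2. Tracial block domination (second half of S1, degenerate ground spaces included) -/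

section Blocks

variable (L : ℕ) [NeZero L]

/-- The Kac block operator with a REAL prefactor `c` is Hermitian. [folklore] -/
theorem isHermitian_real_smul_sum_blockPair (R : ℕ) (c : ℝ) :
    (((c : ℝ) : ℂ) • ∑ a : TorusSite 2 L,
      (∑ u : Fin 2 → Fin R, localPair dWaveFormFactor L (a + fun i => ((u i : ℕ) : ZMod L)))ᴴ *
        (∑ u : Fin 2 → Fin R, localPair dWaveFormFactor L (a + fun i => ((u i : ℕ) : ZMod L)))).IsHermitian := by
  unfold Matrix.IsHermitian
  rw [Matrix.conjTranspose_smul, Matrix.conjTranspose_sum]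
  congr 1
  · rw [Complex.star_def, Complex.conj_ofReal]
  · refine Finset.sum_congr rfl fun a _ => ?_
    rw [Matrix.conjTranspose_mul, Matrix.conjTranspose_conjTranspose]

/-- **Tracial block domination**: `(re ω_A(P))² ≤ L² · re ω_A(W_R)` for the tracial ground state of every
Hermitian `A` and every block scale `R ≥ 1` — the twin's vector inequality `re⟨ψ, P†P ψ⟩ ≤ L² re⟨ψ, W_R ψ⟩`
(`Σ_a B_a = R²P` and Cauchy–Schwarz over the anchors) holds as an operator inequality, the tracial state is
positive, and `(re ω(P))² ≤ |ω(P)|² ≤ re ω(P†P)`. This is the second half of stub S1 with the possibly degenerate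
ground state of `T_h + κ W_R` (the first half is the variational chord). [folklore] -/
theorem sq_re_gsf_pairField_le_blockRepulsion (R : ℕ) (hR : 0 < R)
    {A : Matrix (Finset (Orb (FermionTorus 2 L))) (Finset (Orb (FermionTorus 2 L))) ℂ} (hA : A.IsHermitian) :
    (A.groundStateFunctional (pairField dWaveFormFactor L)).re ^ 2 ≤
      (L : ℝ) ^ 2 * (A.groundStateFunctional (((((R : ℝ) ^ 4)⁻¹ : ℝ) : ℂ) • ∑ a : TorusSite 2 L,
        (∑ u : Fin 2 → Fin R, localPair dWaveFormFactor L (a + fun i => ((u i : ℕ) : ZMod L)))ᴴ *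
          (∑ u : Fin 2 → Fin R, localPair dWaveFormFactor L (a + fun i => ((u i : ℕ) : ZMod L))))).re := by
  have h1 := sq_re_groundStateFunctional_le hA (pairField dWaveFormFactor L)
  have h2 : (A.groundStateFunctional ((pairField dWaveFormFactor L)ᴴ * pairField dWaveFormFactor L)).re ≤
      (A.groundStateFunctional ((((L : ℝ) ^ 2 : ℝ) : ℂ) • ((((((R : ℝ) ^ 4)⁻¹ : ℝ) : ℂ) • ∑ a : TorusSite 2 L,
        (∑ u : Fin 2 → Fin R, localPair dWaveFormFactor L (a + fun i => ((u i : ℕ) : ZMod L)))ᴴ *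
          (∑ u : Fin 2 → Fin R, localPair dWaveFormFactor L (a + fun i => ((u i : ℕ) : ZMod L))))))).re := by
    refine re_groundStateFunctional_mono (isHermitian_conjTranspose_mul_self _)
      (Matrix.IsHermitian.smul (isHermitian_real_smul_sum_blockPair L R _)
        (by rw [isSelfAdjoint_iff, Complex.star_def, Complex.conj_ofReal])) fun x => ?_
    have := re_expect_pairIntensity_le_sq_mul_blockRepulsion L R hR x
    unfold expect at this
    rw [smul_mulVec, dotProduct_smul, smul_eq_mul, Complex.re_ofReal_mul]
    exact this
  rw [LinearMap.map_smul, smul_eq_mul, Complex.re_ofReal_mul] at h2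
  exact h1.trans h2

/-- Every Kac block operator annihilates the Fock vacuum (`B_a ∅ = 0`). [folklore] -/
theorem blockOp_mulVec_vacuum (R : ℕ) (c : ℂ) :
    (c • ∑ a : TorusSite 2 L,
      (∑ u : Fin 2 → Fin R, localPair dWaveFormFactor L (a + fun i => ((u i : ℕ) : ZMod L)))ᴴ *
        (∑ u : Fin 2 → Fin R, localPair dWaveFormFactor L (a + fun i => ((u i : ℕ) : ZMod L)))) *ᵥ
      (vacuum : Fock (Orb (FermionTorus 2 L))) = 0 := by
  have hB : ∀ a : TorusSite 2 L,
      (∑ u : Fin 2 → Fin R, localPair dWaveFormFactor L (a + fun i => ((u i : ℕ) : ZMod L))) *ᵥ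
        (vacuum : Fock (Orb (FermionTorus 2 L))) = 0 := by
    intro a
    rw [Matrix.sum_mulVec]
    exact Finset.sum_eq_zero fun u _ => localPair_mulVec_vacuum _ L _
  rw [Matrix.smul_mulVec, Matrix.sum_mulVec]
  have : ∀ a : TorusSite 2 L,
      ((∑ u : Fin 2 → Fin R, localPair dWaveFormFactor L (a + fun i => ((u i : ℕ) : ZMod L)))ᴴ *
        (∑ u : Fin 2 → Fin R, localPair dWaveFormFactor L (a + fun i => ((u i : ℕ) : ZMod L)))) *ᵥ
          (vacuum : Fock (Orb (FermionTorus 2 L))) = 0 := by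
    intro a
    rw [← Matrix.mulVec_mulVec, hB, Matrix.mulVec_zero]
  simp [this]

/-- The pair field annihilates the vacuum. [folklore] -/
theorem pairField_mulVec_vacuum :
    pairField dWaveFormFactor L *ᵥ (vacuum : Fock (Orb (FermionTorus 2 L))) = 0 := by
  rw [pairField, Matrix.sum_mulVec]
  exact Finset.sum_eq_zero fun x _ => localPair_mulVec_vacuum _ L _

omit [NeZero L] in
/-- The total number operator annihilates the vacuum. [folklore] -/
theorem totalNumber_mulVec_vacuum' :
    (totalNumber : Matrix (Finset (Orb (FermionTorus 2 L))) (Finset (Orb (FermionTorus 2 L))) ℂ) *ᵥ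
      (vacuum : Fock (Orb (FermionTorus 2 L))) = 0 := by
  have han : ∀ (A : Matrix (Finset (Orb (FermionTorus 2 L))) (Finset (Orb (FermionTorus 2 L))) ℂ)
      (i : Orb (FermionTorus 2 L)), (A * annihilation i) *ᵥ (vacuum : Fock (Orb (FermionTorus 2 L))) = 0 :=
    fun A i => by rw [← mulVec_mulVec, annihilation_mulVec_vacuum_holds, mulVec_zero]
  simp only [totalNumber, numberOp, creation, Matrix.sum_mulVec, han, Finset.sum_const_zero]

/-- **The vacuum has zero sourced energy**: `re⟨∅, T_h ∅⟩ = 0` for `T_h = K_μ - h(P + Pᴴ)` (every term of `K_μ`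
and `P` ends in an annihilation operator; `⟨∅, Pᴴ ∅⟩ = conj⟨P∅, ∅⟩ = 0`). [folklore] -/
theorem re_vacuum_expect_dWaveSourceTorus (U μ h : ℝ) :
    (star (vacuum : Fock (Orb (FermionTorus 2 L))) ⬝ᵥ dWaveSourceTorus L U μ h *ᵥ vacuum).re = 0 := by
  have hK : hubbardTorusWith 2 L 1 U μ *ᵥ (vacuum : Fock (Orb (FermionTorus 2 L))) = 0 := by
    rw [hubbardTorusWith_eq, sub_mulVec, smul_mulVec, totalNumber_mulVec_vacuum', smul_zero, sub_zero,
      hubbardTorus]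
    exact hamiltonian_mulVec_vacuum _ 1 U
  have hPH : star (vacuum : Fock (Orb (FermionTorus 2 L))) ⬝ᵥ
      (pairField dWaveFormFactor L)ᴴ *ᵥ (vacuum : Fock (Orb (FermionTorus 2 L))) = 0 := by
    rw [dotProduct_mulVec, vecMul_conjTranspose, star_star, pairField_mulVec_vacuum, star_zero, zero_dotProduct]
  rw [dWaveSourceTorus, sub_mulVec, hK, zero_sub, smul_mulVec, add_mulVec, pairField_mulVec_vacuum, zero_add,
    dotProduct_neg, dotProduct_smul, hPH, smul_zero, neg_zero, Complex.zero_re]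

/-- **The `κ`-ceiling for the block-repelled sourced torus**: for `κ ≥ 0` and every scale `R ≥ 1`, the sourced
tracial pair amplitude of `T_h + κ W_R` obeys `κ · (re ω(P))² ≤ -L² · E₀(T_h)`. Consequently an `R`-uniform floor
`a ≤ re ω(P)/L²` (stub S2) forces `κ(R) · a² ≤ -E₀(T_h)/L²`, a bounded energy density: S2 with `∀ κ > 0` in
place of `∃ κ > 0` is false whenever its hypotheses hold, and the admissible couplings live below `e/a²`.
[folklore] -/
theorem repelled_pairAmplitude_sq_le (R : ℕ) (hR : 0 < R) (U μ h : ℝ) {κ : ℝ} (hκ : 0 ≤ κ) :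
    κ * ((dWaveSourceTorus L U μ h + (κ : ℂ) • (((((R : ℝ) ^ 4)⁻¹ : ℝ) : ℂ) • ∑ a : TorusSite 2 L,
        (∑ u : Fin 2 → Fin R, localPair dWaveFormFactor L (a + fun i => ((u i : ℕ) : ZMod L)))ᴴ *
          (∑ u : Fin 2 → Fin R, localPair dWaveFormFactor L (a + fun i => ((u i : ℕ) : ZMod L))))).groundStateFunctional
        (pairField dWaveFormFactor L)).re ^ 2 ≤
      -((L : ℝ) ^ 2 * (dWaveSourceTorus L U μ h).groundEnergy) := by
  have hT : (dWaveSourceTorus L U μ h).IsHermitian :=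
    dWaveSourceTorus_isHermitian L (isHermitian_hubbardTorusWith L 1 U μ) h
  have hW := isHermitian_real_smul_sum_blockPair L R (((R : ℝ) ^ 4)⁻¹)
  have hA := isHermitian_add_real_smul hT hW κ
  have hdom := sq_re_gsf_pairField_le_blockRepulsion L R hR hA
  have hceil := mul_re_gsf_le_rayleigh_sub_groundEnergy hT hW κ star_vacuum_dotProduct_vacuum
    (blockOp_mulVec_vacuum L R _)
  rw [re_vacuum_expect_dWaveSourceTorus, zero_sub] at hceil
  have hL : (0 : ℝ) ≤ (L : ℝ) ^ 2 := by positivity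
  calc κ * _ ≤ κ * ((L : ℝ) ^ 2 * _) := mul_le_mul_of_nonneg_left hdom hκ
    _ = (L : ℝ) ^ 2 * (κ * _) := by ring
    _ ≤ (L : ℝ) ^ 2 * (-(dWaveSourceTorus L U μ h).groundEnergy) := mul_le_mul_of_nonneg_left hceil hL
    _ = _ := by ring

end Blocks

end Summit.HubbardSuperconductivity.HubbardSuperconductivity.Theorems.CwSsbToEvenTorusLRO.Negative

end
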